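import Summits.Ventures.Crystal3D.Theorems.StickyWulffConstantCoaxialWallLawWordRigidityMulti
import Summits.Ventures.Crystal3D.Theorems.StickyWulffConstantCoaxialWallLawWordNoGlideMirror
import HarnessLib

/-!
# ROOT SEPARATION: classes grown from different roots never share a direction (v2 LEMMA X, algebraic core)
# (crux `CoaxialWallLaw`, stmt-Ventures-19481, line `WallLedgerF`)

HONEST FRAMING. Venture `Summits/Ventures/Crystal3D` (cell `crystal3d-full`), helper `--supports` the crux
`CoaxialWallLaw` of `route-Ventures-StickyWulffConstant` (REGISTERED line `WallLedgerF`).  Rung credit; F-C1 not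
moved; no census, no kissing facts; pure word algebra.  cf-p1 g28 (xxxviii″)/§86(116): the census key moved to
`WordVersion.v2` (NARROW straight move), and the v2 re-instantiation of the word chain has ONE new mathematical input,
the v2 form of LEMMA X (`word_target_ne_of_roots_ne`): two movers at one ball grown from different roots `r₁ ≠ ±r₂`
have different targets.  With NARROW movers only four balls are read, so the geometric v1 proof does not transfer;
but a target coincidence of two STRAIGHT movers (FULL, GLIDE or NARROW alike) says exactly that the two classes have
the SAME DIRECTION VECTOR, `F κ₁ (±r₁) = F κ₂ (±r₂)` — and that never happens:

* `foldl_reflect_not_mem_fcc` — the single-vector 3-adic non-return (`mirrorChain_not_mem`): a nonempty `±1/3`-chain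
  of model mirrors applied to a slot OBLIQUE to the first mirror lands OUTSIDE `Λ₀`;
* **`foldl_reflect_slot_ne`** — ROOT SEPARATION (model form): for `±1/3`-chains `κ₁, κ₂` of unit model menu normals
  all oblique to the slots `x₁` resp. `x₂` (`x₁ ≠ ±x₂`), `κ₁.foldl R x₁ ≠ κ₂.foldl R x₂`.  Proof: peel equal-or-antipodal
  deepest letters (same mirror) by induction; at the first genuinely different deepest pair the glued list
  `κ₁ ++ κ₂.reverse` is a `±1/3`-chain mapping the slot `x₁` to the slot `x₂` — impossible by non-return; an exhausted
  side leaves a chain of the other word mapping its root to a slot — impossible again;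
* `word_u_eq_pow_smul`, `word_letters_oblique_of_wf` — in a well-formed word every letter is oblique to the root;
* **`word_dir_ne_of_roots_ne`** — frame form: well-formed `κ₁` (root `u₁ [] = ±r₁`), `κ₂` (root `u₂ [] = ±r₂`) over one
  plate frame `F [] ` have `F κ₁ (u₁ κ₁) ≠ F κ₂ (u₂ κ₂)` and `≠ −F κ₂ (u₂ κ₂)`.
Exact check (calc/lemmaX_dirs.py, depth ≤ 5, 132 directions per root family): 0 coincidences.
WHAT THIS IS NOT: the v2 LEMMA X itself (next: the cross cases reduce to extended classes) nor the v2 chain; F-C1 not moved.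
-/

noncomputable section

namespace Summit.Ventures.Crystal3D.Theorems

open Summit.Ventures.Crystal3D Finset NearIdentity
open Literature.MathematicalPhysics.StatisticalMechanics (barlowPos barlowStacking fccStacking constHagg)
open Literature.Barriers.AtomisticToContinuum (barlowAddSubgroupOfConst)
open scoped InnerProductSpace

/-! ### Single-vector non-return -/

/-- **A nonempty `±1/3`-chain of model mirrors moves an oblique slot off the lattice.**  Letters `μ₁ :: κ'` (unit model
menu normals, consecutive at `±1/3`), `u` a slot with `⟪u, μ₁⟫ = ±√(2/3)` (oblique to the FIRST mirror applied):
`(μ₁ :: κ').foldl R u ∉ Λ₀`. -/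
theorem foldl_reflect_not_mem_fcc (μ₁ : EuclideanSpace ℝ (Fin 3)) (κ' : List (EuclideanSpace ℝ (Fin 3)))
    (hμ : ∀ μ ∈ μ₁ :: κ', ‖μ‖ = 1 ∧
      ∀ w ∈ fccSlots, ⟪w, μ⟫_ℝ = 0 ∨ ⟪w, μ⟫_ℝ = Real.sqrt (2 / 3) ∨ ⟪w, μ⟫_ℝ = -Real.sqrt (2 / 3))
    (hchain : List.IsChain (fun μ μ' => ⟪μ, μ'⟫_ℝ = 1 / 3 ∨ ⟪μ, μ'⟫_ℝ = -1 / 3) (μ₁ :: κ'))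
    {u : EuclideanSpace ℝ (Fin 3)} (hu : u ∈ fccSlots)
    (hobl : ⟪u, μ₁⟫_ℝ = Real.sqrt (2 / 3) ∨ ⟪u, μ₁⟫_ℝ = -Real.sqrt (2 / 3)) :
    (μ₁ :: κ').foldl (fun (y : EuclideanSpace ℝ (Fin 3)) μ => y - (2 * ⟪y, μ⟫_ℝ) • μ) u ∉
      fccStacking 1 (Real.sqrt (2 / 3)) := by
  have h6 : 0 < Real.sqrt 6 := Real.sqrt_pos.2 (by norm_num)
  have h66 : Real.sqrt 6 * Real.sqrt 6 = 6 := Real.mul_self_sqrt (by norm_num)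
  have hr : 0 < Real.sqrt (2 / 3) := Real.sqrt_pos.2 (by norm_num)
  have h6r : Real.sqrt 6 * Real.sqrt (2 / 3) = 2 := by
    rw [← Real.sqrt_mul (by norm_num)]
    rw [show (6 : ℝ) * (2 / 3) = 2 ^ 2 by norm_num, Real.sqrt_sq (by norm_num)]
  -- the lattice as a set with its closure properties
  set M : Set (EuclideanSpace ℝ (Fin 3)) := fccStacking 1 (Real.sqrt (2 / 3)) with hM
  set G₁ : AddSubgroup (EuclideanSpace ℝ (Fin 3)) :=
    barlowAddSubgroupOfConst 1 (Real.sqrt (2 / 3)) constHagg (fun _ => rfl) with hG₁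
  have hG₁mem : ∀ w, w ∈ G₁ ↔ w ∈ fccStacking 1 (Real.sqrt (2 / 3)) := fun w => Iff.rfl
  have hadd : ∀ x ∈ M, ∀ y ∈ M, x + y ∈ M := fun x hx y hy => fcc_add_site_mem hx hy
  have hzs : ∀ (z : ℤ), ∀ x ∈ M, (z : ℝ) • x ∈ M := by
    intro z x hx
    have := G₁.zsmul_mem ((hG₁mem x).2 hx) z
    rw [hG₁mem] at this
    rw [← Int.cast_smul_eq_zsmul ℝ] at this
    exact this
  have hint : ∀ w ∈ M, ∃ z : ℤ, ‖w‖ ^ 2 = z := fun w hw => exists_int_norm_sq_of_mem_fcc hw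
  -- the axes `√6 μ`
  set s : EuclideanSpace ℝ (Fin 3) → EuclideanSpace ℝ (Fin 3) := fun μ => Real.sqrt 6 • μ with hs
  set ts := κ'.reverse.map s with hts
  set tl := s μ₁ with htl
  have hlist : ts ++ [tl] = (μ₁ :: κ').reverse.map s := by
    rw [hts, htl, List.reverse_cons, List.map_append, List.map_singleton]
  have haxes : ∀ t ∈ ts ++ [tl], t ∈ M ∧ ∀ w ∈ M, ∃ z : ℤ, ⟪w, t⟫_ℝ = z := by
    intro t ht
    rw [hlist, List.mem_map] at ht
    obtain ⟨μ, hμm, rfl⟩ := ht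
    rw [List.mem_reverse] at hμm
    obtain ⟨hn, hmn⟩ := hμ μ hμm
    exact sqrt6_smul_menuNormal_mem hn hmn
  have hchain' : List.IsChain (fun t t' => ⟪t, t'⟫_ℝ = 2 ∨ ⟪t, t'⟫_ℝ = -2) (ts ++ [tl]) := by
    have hrev : List.IsChain (fun μ μ' : EuclideanSpace ℝ (Fin 3) => ⟪μ, μ'⟫_ℝ = 1 / 3 ∨ ⟪μ, μ'⟫_ℝ = -1 / 3)
        (μ₁ :: κ').reverse := by
      rw [List.isChain_reverse]
      exact hchain.imp fun a b h => by rw [real_inner_comm]; exact h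
    have hmap := List.isChain_map_of_isChain (R := fun μ μ' : EuclideanSpace ℝ (Fin 3) =>
        ⟪μ, μ'⟫_ℝ = 1 / 3 ∨ ⟪μ, μ'⟫_ℝ = -1 / 3)
      (S := fun t t' : EuclideanSpace ℝ (Fin 3) => ⟪t, t'⟫_ℝ = 2 ∨ ⟪t, t'⟫_ℝ = -2) s (fun a b h => by
        show ⟪s a, s b⟫_ℝ = 2 ∨ ⟪s a, s b⟫_ℝ = -2
        rw [hs]
        simp only [real_inner_smul_left, real_inner_smul_right]
        rcases h with h | h <;> rw [h]
        · left; nlinarith [h66]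
        · right; nlinarith [h66]) hrev
    rw [hlist]; exact hmap
  have hnorm : ‖(ts ++ [tl]).headD tl‖ ^ 2 = 6 := by
    have hall : ∀ t ∈ ts ++ [tl], ‖t‖ ^ 2 = 6 := by
      intro t ht
      rw [hlist, List.mem_map] at ht
      obtain ⟨μ, hμm, rfl⟩ := ht
      rw [List.mem_reverse] at hμm
      rw [hs, norm_smul, mul_pow, (hμ μ hμm).1, Real.norm_eq_abs, abs_of_pos h6, one_pow, mul_one, sq, h66]
    cases hc : ts with
    | nil => exact hall tl (by simp)
    | cons t rest => exact hall t (by rw [hc]; simp)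
  -- obliqueness of `u` to the first mirror
  have hut : ⟪u, tl⟫_ℝ = 2 ∨ ⟪u, tl⟫_ℝ = -2 := by
    rw [htl, hs]; simp only [real_inner_smul_right]
    rcases hobl with h | h <;> rw [h]
    · left; rw [h6r]
    · right; rw [mul_neg, h6r]
  have key := mirrorChain_not_mem M hadd hzs hint ts tl haxes hchain' hnorm (mem_fcc_of_mem_fccSlots hu) hut
  -- the abstract chain is the composed reflection
  have hgen : ∀ (l : List (EuclideanSpace ℝ (Fin 3))) (v : EuclideanSpace ℝ (Fin 3)),
      (l.map s).foldr (fun t (x : EuclideanSpace ℝ (Fin 3)) => x - (⟪x, t⟫_ℝ / 3) • t) v =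
        l.foldr (fun μ (x : EuclideanSpace ℝ (Fin 3)) => x - (2 * ⟪x, μ⟫_ℝ) • μ) v := by
    intro l v
    induction l with
    | nil => rfl
    | cons μ l ih =>
      simp only [List.map_cons, List.foldr_cons, ih]
      rw [hs]
      simp only [real_inner_smul_right, smul_smul]
      congr 2
      have : Real.sqrt 6 * ⟪List.foldr (fun μ x => x - (2 * ⟪x, μ⟫_ℝ) • μ) v l, μ⟫_ℝ / 3 * Real.sqrt 6 =
          Real.sqrt 6 * Real.sqrt 6 / 3 * ⟪List.foldr (fun μ x => x - (2 * ⟪x, μ⟫_ℝ) • μ) v l, μ⟫_ℝ := by ring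
      rw [this, h66]; ring
  have hfold : (ts ++ [tl]).foldr (fun t (x : EuclideanSpace ℝ (Fin 3)) => x - (⟪x, t⟫_ℝ / 3) • t) u =
      (μ₁ :: κ').foldl (fun (y : EuclideanSpace ℝ (Fin 3)) μ => y - (2 * ⟪y, μ⟫_ℝ) • μ) u := by
    rw [hlist, hgen, List.foldr_reverse]
  rw [hfold] at key
  exact key

/-! ### Root separation, model form -/

/-- **ROOT SEPARATION (model form).**  See the module docstring. -/
theorem foldl_reflect_slot_ne :
    ∀ (κ₁ κ₂ : List (EuclideanSpace ℝ (Fin 3))),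
    (∀ μ ∈ κ₁, ‖μ‖ = 1 ∧
      ∀ w ∈ fccSlots, ⟪w, μ⟫_ℝ = 0 ∨ ⟪w, μ⟫_ℝ = Real.sqrt (2 / 3) ∨ ⟪w, μ⟫_ℝ = -Real.sqrt (2 / 3)) →
    (∀ μ ∈ κ₂, ‖μ‖ = 1 ∧
      ∀ w ∈ fccSlots, ⟪w, μ⟫_ℝ = 0 ∨ ⟪w, μ⟫_ℝ = Real.sqrt (2 / 3) ∨ ⟪w, μ⟫_ℝ = -Real.sqrt (2 / 3)) →
    List.IsChain (fun μ μ' => ⟪μ, μ'⟫_ℝ = 1 / 3 ∨ ⟪μ, μ'⟫_ℝ = -1 / 3) κ₁ →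
    List.IsChain (fun μ μ' => ⟪μ, μ'⟫_ℝ = 1 / 3 ∨ ⟪μ, μ'⟫_ℝ = -1 / 3) κ₂ →
    ∀ {x₁ x₂ : EuclideanSpace ℝ (Fin 3)}, x₁ ∈ fccSlots → x₂ ∈ fccSlots → x₁ ≠ x₂ → x₁ ≠ -x₂ →
    (∀ μ ∈ κ₁, ⟪x₁, μ⟫_ℝ = Real.sqrt (2 / 3) ∨ ⟪x₁, μ⟫_ℝ = -Real.sqrt (2 / 3)) →
    (∀ μ ∈ κ₂, ⟪x₂, μ⟫_ℝ = Real.sqrt (2 / 3) ∨ ⟪x₂, μ⟫_ℝ = -Real.sqrt (2 / 3)) →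
    κ₁.foldl (fun (y : EuclideanSpace ℝ (Fin 3)) μ => y - (2 * ⟪y, μ⟫_ℝ) • μ) x₁ ≠
      κ₂.foldl (fun (y : EuclideanSpace ℝ (Fin 3)) μ => y - (2 * ⟪y, μ⟫_ℝ) • μ) x₂ := by
  -- head exhaustion: a nonempty chain whose FIRST mirror is oblique to the slot `x` cannot land on a slot
  have headCase : ∀ (κ : List (EuclideanSpace ℝ (Fin 3))),
      (∀ μ ∈ κ, ‖μ‖ = 1 ∧
        ∀ w ∈ fccSlots, ⟪w, μ⟫_ℝ = 0 ∨ ⟪w, μ⟫_ℝ = Real.sqrt (2 / 3) ∨ ⟪w, μ⟫_ℝ = -Real.sqrt (2 / 3)) →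
      List.IsChain (fun μ μ' => ⟪μ, μ'⟫_ℝ = 1 / 3 ∨ ⟪μ, μ'⟫_ℝ = -1 / 3) κ →
      ∀ {x y : EuclideanSpace ℝ (Fin 3)}, x ∈ fccSlots → y ∈ fccSlots →
      (∀ μ, κ.head? = some μ → (⟪x, μ⟫_ℝ = Real.sqrt (2 / 3) ∨ ⟪x, μ⟫_ℝ = -Real.sqrt (2 / 3))) → κ ≠ [] →
      κ.foldl (fun (y : EuclideanSpace ℝ (Fin 3)) μ => y - (2 * ⟪y, μ⟫_ℝ) • μ) x ≠ y := by
    intro κ hκ hch x y hx hy hob hne heq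
    obtain ⟨μ₁, κ', rfl⟩ := List.exists_cons_of_ne_nil hne
    have h := foldl_reflect_not_mem_fcc μ₁ κ' hκ hch hx (hob μ₁ rfl)
    rw [heq] at h
    exact h (mem_fcc_of_mem_fccSlots hy)
  -- the head of a nonempty word is one of its letters
  have headMem : ∀ (κ r : List (EuclideanSpace ℝ (Fin 3))) (μ : EuclideanSpace ℝ (Fin 3)), κ ≠ [] →
      (κ ++ r).head? = some μ → μ ∈ κ := by
    intro κ r μ hne h
    obtain ⟨ν, t, rfl⟩ := List.exists_cons_of_ne_nil hne
    rw [List.cons_append, List.head?_cons, Option.some.injEq] at h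
    rw [← h]; exact List.mem_cons_self
  intro κ₁
  induction κ₁ using List.reverseRecOn with
  | nil =>
    intro κ₂ _ hκ₂ _ hch₂ x₁ x₂ hx₁ hx₂ hne _ _ hob₂ heq
    rw [List.foldl_nil] at heq
    by_cases h0 : κ₂ = []
    · rw [h0, List.foldl_nil] at heq; exact hne heq
    · refine headCase κ₂ hκ₂ hch₂ hx₂ hx₁ (fun μ hμ => hob₂ μ ?_) h0 heq.symm
      have := headMem κ₂ [] μ h0 (by rw [List.append_nil]; exact hμ)
      exact this
  | append_singleton l₁ a ih =>
    intro κ₂ hκ₁ hκ₂ hch₁ hch₂ x₁ x₂ hx₁ hx₂ hne hne' hob₁ hob₂ heq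
    rcases List.eq_nil_or_concat κ₂ with h0 | ⟨l₂, b, h0⟩
    · rw [h0, List.foldl_nil] at heq
      exact headCase (l₁ ++ [a]) hκ₁ hch₁ hx₁ hx₂
        (fun μ hμ => hob₁ μ (headMem (l₁ ++ [a]) [] μ (by simp) (by rw [List.append_nil]; exact hμ))) (by simp) heq
    rw [List.concat_eq_append] at h0
    subst h0
    -- data of the deepest letters
    have ha : ‖a‖ = 1 ∧ ∀ w ∈ fccSlots, ⟪w, a⟫_ℝ = 0 ∨ ⟪w, a⟫_ℝ = Real.sqrt (2 / 3) ∨ ⟪w, a⟫_ℝ = -Real.sqrt (2 / 3) :=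
      hκ₁ a (by simp)
    have hb : ‖b‖ = 1 ∧ ∀ w ∈ fccSlots, ⟪w, b⟫_ℝ = 0 ∨ ⟪w, b⟫_ℝ = Real.sqrt (2 / 3) ∨ ⟪w, b⟫_ℝ = -Real.sqrt (2 / 3) :=
      hκ₂ b (by simp)
    -- restrictions to the prefixes
    have hκ₁' : ∀ μ ∈ l₁, ‖μ‖ = 1 ∧
        ∀ w ∈ fccSlots, ⟪w, μ⟫_ℝ = 0 ∨ ⟪w, μ⟫_ℝ = Real.sqrt (2 / 3) ∨ ⟪w, μ⟫_ℝ = -Real.sqrt (2 / 3) :=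
      fun μ hμ => hκ₁ μ (List.mem_append_left _ hμ)
    have hκ₂' : ∀ μ ∈ l₂, ‖μ‖ = 1 ∧
        ∀ w ∈ fccSlots, ⟪w, μ⟫_ℝ = 0 ∨ ⟪w, μ⟫_ℝ = Real.sqrt (2 / 3) ∨ ⟪w, μ⟫_ℝ = -Real.sqrt (2 / 3) :=
      fun μ hμ => hκ₂ μ (List.mem_append_left _ hμ)
    have hch₁' : List.IsChain (fun μ μ' => ⟪μ, μ'⟫_ℝ = 1 / 3 ∨ ⟪μ, μ'⟫_ℝ = -1 / 3) l₁ := (List.isChain_append.1 hch₁).1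
    have hch₂' : List.IsChain (fun μ μ' => ⟪μ, μ'⟫_ℝ = 1 / 3 ∨ ⟪μ, μ'⟫_ℝ = -1 / 3) l₂ := (List.isChain_append.1 hch₂).1
    have hob₁' : ∀ μ ∈ l₁, ⟪x₁, μ⟫_ℝ = Real.sqrt (2 / 3) ∨ ⟪x₁, μ⟫_ℝ = -Real.sqrt (2 / 3) :=
      fun μ hμ => hob₁ μ (List.mem_append_left _ hμ)
    have hob₂' : ∀ μ ∈ l₂, ⟪x₂, μ⟫_ℝ = Real.sqrt (2 / 3) ∨ ⟪x₂, μ⟫_ℝ = -Real.sqrt (2 / 3) :=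
      fun μ hμ => hob₂ μ (List.mem_append_left _ hμ)
    -- peel the deepest letters
    set y₁ := l₁.foldl (fun (y : EuclideanSpace ℝ (Fin 3)) μ => y - (2 * ⟪y, μ⟫_ℝ) • μ) x₁ with hy₁
    set y₂ := l₂.foldl (fun (y : EuclideanSpace ℝ (Fin 3)) μ => y - (2 * ⟪y, μ⟫_ℝ) • μ) x₂ with hy₂
    have heq' : y₁ - (2 * ⟪y₁, a⟫_ℝ) • a = y₂ - (2 * ⟪y₂, b⟫_ℝ) • b := by
      simpa only [List.foldl_append, List.foldl_cons, List.foldl_nil] using heq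
    by_cases hab : a = b ∨ a = -b
    · -- same mirror: cancel and induct
      have hsame : y₁ - (2 * ⟪y₁, a⟫_ℝ) • a = y₂ - (2 * ⟪y₂, a⟫_ℝ) • a := by
        rcases hab with rfl | rfl
        · exact heq'
        · rw [heq', ← reflect_neg_eq y₂ b]
      have hyy : y₁ = y₂ := by
        have := congrArg (fun y => y - (2 * ⟪y, a⟫_ℝ) • a) hsame
        simpa only [reflect_reflect_unit ha.1] using this
      exact ih l₂ hκ₁' hκ₂' hch₁' hch₂' hx₁ hx₂ hne hne' hob₁' hob₂' hyy
    · -- genuinely different deepest letters: the glued list is a `±1/3`-chain taking the slot `x₁` to the slot `x₂`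
      push Not at hab
      have hglue : ((l₁ ++ [a]) ++ (l₂ ++ [b]).reverse).foldl
          (fun (y : EuclideanSpace ℝ (Fin 3)) μ => y - (2 * ⟪y, μ⟫_ℝ) • μ) x₁ = x₂ := by
        rw [List.foldl_append, heq]
        exact foldl_reflect_reverse_foldl (l₂ ++ [b]) (fun μ hμ => (hκ₂ μ hμ).1) x₂
      refine headCase ((l₁ ++ [a]) ++ (l₂ ++ [b]).reverse) ?_ ?_ hx₁ hx₂ ?_ (by simp) hglue
      · intro μ hμ
        rcases List.mem_append.1 hμ with h | h
        · exact hκ₁ μ h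
        · exact hκ₂ μ (List.mem_reverse.1 h)
      · rw [List.isChain_append]
        refine ⟨hch₁, ?_, ?_⟩
        · rw [List.isChain_reverse]
          exact hch₂.imp fun u v h => by rw [real_inner_comm]; exact h
        · intro x hx y hy
          rw [List.getLast?_concat] at hx
          rw [List.reverse_append, List.reverse_singleton, List.singleton_append, List.head?_cons] at hy
          simp only [Option.mem_def, Option.some.injEq] at hx hy
          subst hx; subst hy
          exact menuNormals_chain_of_ne_of_ne_neg ha.1 hb.1 ha.2 hb.2 hab.1 (fun h => hab.2 (by rw [h, neg_neg]))
      · intro μ hμ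
        exact hob₁ μ (headMem (l₁ ++ [a]) _ μ (by simp) hμ)

/-! ### Root separation, frame form -/

section Frames

variable {F : List (EuclideanSpace ℝ (Fin 3)) → (EuclideanSpace ℝ (Fin 3) ≃ₗᵢ[ℝ] EuclideanSpace ℝ (Fin 3))}

/-- In a word system the root direction alternates: `u κ = (−1)^{|κ|} • u []`. -/
theorem word_u_eq_pow_smul {u : List (EuclideanSpace ℝ (Fin 3)) → EuclideanSpace ℝ (Fin 3)}
    (huc : ∀ μ κ, u (μ :: κ) = -u κ) : ∀ κ, u κ = ((-1 : ℝ) ^ κ.length) • u [] := by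
  intro κ
  induction κ with
  | nil => simp
  | cons μ κ ih => rw [huc, ih, List.length_cons, pow_succ]; module

/-- **Every letter of a well-formed word is oblique to the root** (`⟪u [], μ⟫ = ±√(2/3)`). -/
theorem word_letters_oblique_of_wf {u : List (EuclideanSpace ℝ (Fin 3)) → EuclideanSpace ℝ (Fin 3)}
    {WF : List (EuclideanSpace ℝ (Fin 3)) → Prop} (huc : ∀ μ κ, u (μ :: κ) = -u κ)
    (hWFc : ∀ μ κ, WF (μ :: κ) ↔ (WF κ ∧ ‖μ‖ = 1 ∧
      (∀ w ∈ fccSlots, ⟪w, μ⟫_ℝ = 0 ∨ ⟪w, μ⟫_ℝ = Real.sqrt (2 / 3) ∨ ⟪w, μ⟫_ℝ = -Real.sqrt (2 / 3)) ∧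
      ⟪u κ, μ⟫_ℝ = Real.sqrt (2 / 3) ∧ ∀ μ' κ', κ = μ' :: κ' → μ' ≠ -μ)) :
    ∀ κ, WF κ → ∀ μ ∈ κ, ⟪u [], μ⟫_ℝ = Real.sqrt (2 / 3) ∨ ⟪u [], μ⟫_ℝ = -Real.sqrt (2 / 3) := by
  intro κ
  induction κ with
  | nil => intro _ μ hμ; simp at hμ
  | cons ν κ ih =>
    intro hκ μ hμ
    obtain ⟨hκ', -, -, hνu, -⟩ := (hWFc ν κ).1 hκ
    rcases List.mem_cons.1 hμ with rfl | hμ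
    · rw [word_u_eq_pow_smul huc κ, real_inner_smul_left] at hνu
      rcases neg_one_pow_eq_or ℝ κ.length with h | h <;> rw [h] at hνu
      · left; linarith
      · right; linarith
    · exact ih hκ' μ hμ

/-- **ROOT SEPARATION (frame form).**  Two well-formed words of one word system family `F` (same plate frame
`F []`) grown from root slots `u₁ [] = x₁`, `u₂ [] = x₂` with `x₁ ≠ ±x₂` have different directions:
`F κ₁ (u₁ κ₁) ≠ F κ₂ (u₂ κ₂)`. -/
theorem word_dir_ne_of_roots_ne (hFc : ∀ μ κ, F (μ :: κ) = ((ℝ ∙ μ)ᗮ.reflection).trans (F κ))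
    {u₁ u₂ : List (EuclideanSpace ℝ (Fin 3)) → EuclideanSpace ℝ (Fin 3)}
    {WF₁ WF₂ : List (EuclideanSpace ℝ (Fin 3)) → Prop}
    (huc₁ : ∀ μ κ, u₁ (μ :: κ) = -u₁ κ) (huc₂ : ∀ μ κ, u₂ (μ :: κ) = -u₂ κ)
    (hWFc₁ : ∀ μ κ, WF₁ (μ :: κ) ↔ (WF₁ κ ∧ ‖μ‖ = 1 ∧
      (∀ w ∈ fccSlots, ⟪w, μ⟫_ℝ = 0 ∨ ⟪w, μ⟫_ℝ = Real.sqrt (2 / 3) ∨ ⟪w, μ⟫_ℝ = -Real.sqrt (2 / 3)) ∧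
      ⟪u₁ κ, μ⟫_ℝ = Real.sqrt (2 / 3) ∧ ∀ μ' κ', κ = μ' :: κ' → μ' ≠ -μ))
    (hWFc₂ : ∀ μ κ, WF₂ (μ :: κ) ↔ (WF₂ κ ∧ ‖μ‖ = 1 ∧
      (∀ w ∈ fccSlots, ⟪w, μ⟫_ℝ = 0 ∨ ⟪w, μ⟫_ℝ = Real.sqrt (2 / 3) ∨ ⟪w, μ⟫_ℝ = -Real.sqrt (2 / 3)) ∧
      ⟪u₂ κ, μ⟫_ℝ = Real.sqrt (2 / 3) ∧ ∀ μ' κ', κ = μ' :: κ' → μ' ≠ -μ))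
    (hx₁ : u₁ [] ∈ fccSlots) (hx₂ : u₂ [] ∈ fccSlots) (hne : u₁ [] ≠ u₂ []) (hne' : u₁ [] ≠ -u₂ [])
    {κ₁ κ₂ : List (EuclideanSpace ℝ (Fin 3))} (hκ₁ : WF₁ κ₁) (hκ₂ : WF₂ κ₂) :
    F κ₁ (u₁ κ₁) ≠ F κ₂ (u₂ κ₂) ∧ F κ₁ (u₁ κ₁) ≠ -F κ₂ (u₂ κ₂) := by
  obtain ⟨hlet₁, hch₁⟩ := word_letters_of_wf huc₁ hWFc₁ κ₁ hκ₁
  obtain ⟨hlet₂, hch₂⟩ := word_letters_of_wf huc₂ hWFc₂ κ₂ hκ₂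
  have hob₁ := word_letters_oblique_of_wf huc₁ hWFc₁ κ₁ hκ₁
  have hob₂ := word_letters_oblique_of_wf huc₂ hWFc₂ κ₂ hκ₂
  have hu₁ : ∀ μ ∈ κ₁, ‖μ‖ = 1 := fun μ hμ => (hlet₁ μ hμ).1
  have hu₂ : ∀ μ ∈ κ₂, ‖μ‖ = 1 := fun μ hμ => (hlet₂ μ hμ).1
  -- `F κ x = F [] (foldl R κ x)`
  have e₁ : ∀ x, F κ₁ x = F [] (κ₁.foldl (fun (y : EuclideanSpace ℝ (Fin 3)) μ => y - (2 * ⟪y, μ⟫_ℝ) • μ) x) := by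
    intro x; have := word_F_append_apply hFc κ₁ hu₁ [] x; rwa [List.append_nil] at this
  have e₂ : ∀ x, F κ₂ x = F [] (κ₂.foldl (fun (y : EuclideanSpace ℝ (Fin 3)) μ => y - (2 * ⟪y, μ⟫_ℝ) • μ) x) := by
    intro x; have := word_F_append_apply hFc κ₂ hu₂ [] x; rwa [List.append_nil] at this
  -- signs: `u κ = ± u []`, and the mirrors are linear so `foldl R κ (−x) = − foldl R κ x`
  have hlin : ∀ (κ : List (EuclideanSpace ℝ (Fin 3))) (c : ℝ) (x : EuclideanSpace ℝ (Fin 3)),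
      κ.foldl (fun (y : EuclideanSpace ℝ (Fin 3)) μ => y - (2 * ⟪y, μ⟫_ℝ) • μ) (c • x) =
        c • κ.foldl (fun (y : EuclideanSpace ℝ (Fin 3)) μ => y - (2 * ⟪y, μ⟫_ℝ) • μ) x := by
    intro κ
    induction κ with
    | nil => intro c x; rfl
    | cons μ κ ih =>
      intro c x
      simp only [List.foldl_cons]
      have : c • x - (2 * ⟪c • x, μ⟫_ℝ) • μ = c • (x - (2 * ⟪x, μ⟫_ℝ) • μ) := by
        rw [real_inner_smul_left]; module
      rw [this, ih]
  -- the slots `±u₂ []` as targets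
  have key : ∀ (c₁ c₂ : ℝ), (c₁ = 1 ∨ c₁ = -1) → (c₂ = 1 ∨ c₂ = -1) →
      κ₁.foldl (fun (y : EuclideanSpace ℝ (Fin 3)) μ => y - (2 * ⟪y, μ⟫_ℝ) • μ) (c₁ • u₁ []) ≠
        κ₂.foldl (fun (y : EuclideanSpace ℝ (Fin 3)) μ => y - (2 * ⟪y, μ⟫_ℝ) • μ) (c₂ • u₂ []) := by
    intro c₁ c₂ hc₁ hc₂
    have hs₁ : c₁ • u₁ [] ∈ fccSlots := by
      rcases hc₁ with rfl | rfl
      · rw [one_smul]; exact hx₁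
      · rw [neg_one_smul]; exact neg_mem_fccSlots hx₁
    have hs₂ : c₂ • u₂ [] ∈ fccSlots := by
      rcases hc₂ with rfl | rfl
      · rw [one_smul]; exact hx₂
      · rw [neg_one_smul]; exact neg_mem_fccSlots hx₂
    have hne₁ : c₁ • u₁ [] ≠ c₂ • u₂ [] := by
      rcases hc₁ with rfl | rfl <;> rcases hc₂ with rfl | rfl
      · simpa using hne
      · rw [one_smul, neg_one_smul]; exact hne'
      · rw [neg_one_smul, one_smul]; intro h; exact hne' (by rw [← h, neg_neg])
      · rw [neg_one_smul, neg_one_smul]; intro h; exact hne (neg_injective h)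
    have hne₁' : c₁ • u₁ [] ≠ -(c₂ • u₂ []) := by
      rcases hc₁ with rfl | rfl <;> rcases hc₂ with rfl | rfl
      · rw [one_smul, one_smul]; exact hne'
      · rw [one_smul, neg_one_smul, neg_neg]; exact hne
      · rw [neg_one_smul, one_smul]; intro h; exact hne (neg_injective h)
      · rw [neg_one_smul, neg_one_smul, neg_neg]; intro h; exact hne' (by rw [← h, neg_neg])
    have hobl₁ : ∀ μ ∈ κ₁, ⟪c₁ • u₁ [], μ⟫_ℝ = Real.sqrt (2 / 3) ∨ ⟪c₁ • u₁ [], μ⟫_ℝ = -Real.sqrt (2 / 3) := by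
      intro μ hμ
      rw [real_inner_smul_left]
      rcases hc₁ with rfl | rfl <;> rcases hob₁ μ hμ with h | h <;> rw [h]
      · left; ring
      · right; ring
      · right; ring
      · left; ring
    have hobl₂ : ∀ μ ∈ κ₂, ⟪c₂ • u₂ [], μ⟫_ℝ = Real.sqrt (2 / 3) ∨ ⟪c₂ • u₂ [], μ⟫_ℝ = -Real.sqrt (2 / 3) := by
      intro μ hμ
      rw [real_inner_smul_left]
      rcases hc₂ with rfl | rfl <;> rcases hob₂ μ hμ with h | h <;> rw [h]
      · left; ring
      · right; ring
      · right; ring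
      · left; ring
    exact foldl_reflect_slot_ne κ₁ κ₂ hlet₁ hlet₂ hch₁ hch₂ hs₁ hs₂ hne₁ hne₁' hobl₁ hobl₂
  have hpow₁ := word_u_eq_pow_smul huc₁ κ₁
  have hpow₂ := word_u_eq_pow_smul huc₂ κ₂
  have hsign : ∀ n : ℕ, ((-1 : ℝ) ^ n = 1) ∨ ((-1 : ℝ) ^ n = -1) := fun n => neg_one_pow_eq_or ℝ n
  constructor
  · intro h
    rw [e₁, e₂] at h
    have h' := (F []).injective h
    rw [hpow₁, hpow₂] at h'
    exact key _ _ (hsign _) (hsign _) h'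
  · intro h
    rw [e₁, e₂, ← map_neg] at h
    have h' := (F []).injective h
    rw [hpow₁, hpow₂] at h'
    have h'' : κ₁.foldl (fun (y : EuclideanSpace ℝ (Fin 3)) μ => y - (2 * ⟪y, μ⟫_ℝ) • μ)
        (((-1 : ℝ) ^ κ₁.length) • u₁ []) =
        κ₂.foldl (fun (y : EuclideanSpace ℝ (Fin 3)) μ => y - (2 * ⟪y, μ⟫_ℝ) • μ)
          (((-1 : ℝ) * (-1 : ℝ) ^ κ₂.length) • u₂ []) := by
      rw [h', hlin κ₂ ((-1 : ℝ) ^ κ₂.length) (u₂ []), hlin κ₂ ((-1 : ℝ) * (-1 : ℝ) ^ κ₂.length) (u₂ [])]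
      module
    refine key _ _ (hsign _) ?_ h''
    rcases hsign κ₂.length with h2 | h2 <;> rw [h2] <;> norm_num

end Frames

end Summit.Ventures.Crystal3D.Theorems

end
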